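import Mathlib
import Literature.RingTheory.MvPowerSeries.OptionEquivLeft
import Summits.ValiantsHypothesis.ValiantsHypothesis.Theorems.BinomialElusiveBinomialCandidateNondegenerateCorankTwoPrep
import Summits.ValiantsHypothesis.ValiantsHypothesis.Theorems.BinomialElusiveBinomialCandidateCorankTwoNormalForm
import Summits.ValiantsHypothesis.ValiantsHypothesis.Theorems.BinomialElusiveBinomialCandidateCorankTwoIterationFree
import Summits.ValiantsHypothesis.ValiantsHypothesis.Theorems.BinomialElusiveBinomialCandidateCorankTwoEliminantMembership
import Summits.ValiantsHypothesis.ValiantsHypothesis.Theorems.BinomialElusiveBinomialCandidateCorankTwoEvaluation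
import Summits.ValiantsHypothesis.ValiantsHypothesis.Theorems.BinomialElusiveBinomialCandidateCorankTwoLink
import Summits.ValiantsHypothesis.ValiantsHypothesis.Theorems.BinomialElusiveBinomialCandidateCorankTwoLeadingMonomial

/-!
# Crux `BinomialElusive.BinomialCandidate` (stmt-ValiantsHypothesis-7392), line `registered`
# (skeleton v6) — stub `stub_nondegenerateCorankTwo`: nondegenerate corank-two base points are
# impossible for E-type data

The registered stub `stub_nondegenerateCorankTwo` of skeleton v6 (lead c2): an integral formal
solution `p` of `Γ(p) = T`, `T_i = t^{N a_i} + t^{N b_i}`, whose base point `y₀ = p(0)` has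
corank EXACTLY two (the Jacobian columns have kernel `span(κ₁, κ₂)`), three independent
functionals `λ_a` killing the image of the Jacobian, and NONDEGENERATE second fundamental form
on the kernel plane (the three binary quadratic forms `x ↦ λ_a · B(x₁κ₁ + x₂κ₂)` have no common
nontrivial zero) cannot exist when the exponents have (P1) no relation of length `≤ 2D` and (P2)
a congruence modulus with factor `D`, `D ≥ 8`.

Proof — the assembly of the corank-two package (model: `stub_shallowCorankOne`):
1. binomials `T`, precision `G`;
2. `nondegenerateCorankTwo_adaptedBasis` (pieces A `binaryQuadratic_squares` and B2
   `kernelPlane_coefficients`): a kernel basis `κ'₁, κ'₂` and functionals `λ'_a` for which the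
   quadratic parts of the first two special equations on the kernel plane are `y²` and `x²`;
3. `corankTwo_normalForm` (piece B) — coordinates `P, S`, polynomials `B_i`, series `q`, and the
   quadratic normalisation `[Y_1²] B_0 = 1`, `[Y_0²] B_1 = 1`, all other kernel-plane quadratic
   coefficients of `B_0, B_1` vanish (`kernelPlane_coefficients`);
4. `corankTwo_iteration_v2` (piece C') — `F₀, F₁, F₂ ∈ ℂ[W, X₁][X₂]` and the kernel-surface jet
   `φ`; their pure parts are read off through `NondegenerateCorankTwo.coeff_aeval_plane`;
5.–7. `NondegenerateCorankTwo.twoLevel_elimination` (pieces D', G, F, H, H', E): `D ∈ ℂ⟦W⟧`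
   with `D(0) = 0`, `coeff_{W_2^8} D = 1`, `D_{<G}(T̂) ≡ 0 (mod t^G)`;
8. transfer `ψ(W) := D_{<G}(P W)` and `lowDegreeVanishing_deg` at degree `8` ((P1) at length
   `16 ≤ 2D`, (P2) with factor `8 ≤ D`): all coefficients of `ψ` of degree `≤ 8` vanish, hence
   (undoing `P`) those of `D_{<G}` — contradicting `coeff_{W_2^8} D = 1`.
-/

-- layout Summits/ValiantsHypothesis/ValiantsHypothesis forces the duplicated namespace component
set_option linter.dupNamespace false

noncomputable section

namespace Summit.ValiantsHypothesis.ValiantsHypothesis.Theorems.BinomialCandidateStubs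

open scoped BigOperators
open MvPolynomial

namespace NondegenerateCorankTwo

open CorankTwoEvaluation in
/-- **The two-level Weierstrass elimination** (steps 5–7 of the assembly).  From the polynomials
`F₀, F₁, F₂ ∈ ℂ[W, X₁][X₂]` (`none = X₁`, `some i = W_i`) of the Picard elimination — evaluations
at (`W := T`, `X₁ := x₁`, `X₂ := x₂`) vanishing below `t^G`; `F₀`, `F₁`, `F₂ + W_2` free of `W_2`;
pure parts `F₀(0; X) = X₂² + (wt ≥ 3)`, `F₁(0; X) = X₁² + (wt ≥ 3)`, `F₂(0; 0) = 0` — to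
`D ∈ ℂ⟦W⟧` with `D(0) = 0`, `coeff_{W_2^8} D = 1`, `(truncTotal G D)(T) ≡ 0 (mod t^G)`: pieces
D' (`eliminantMembership_option`), G (`axis_det_order_four`), `corankOne_eliminantMembership`
after `optionEquivLeft`, F (`corankTwo_leadingMonomial`), H', E, H (evaluation). -/
theorem twoLevel_elimination :
    ∀ (m G : ℕ) (F₀ F₁ F₂ : Polynomial (MvPolynomial (Option (Fin (m + 3))) ℂ))
      (T : Fin (m + 3) → LaurentSeries ℂ) (x₁ x₂ : LaurentSeries ℂ),
      (∀ i, ∀ g : ℤ, g < 1 → (T i).coeff g = 0) → (∀ g : ℤ, g < 1 → x₁.coeff g = 0) →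
      (∀ g : ℤ, g < 1 → x₂.coeff g = 0) →
      (∀ g : ℤ, g < G → (Polynomial.eval₂ (MvPolynomial.aeval
        (fun o : Option (Fin (m + 3)) => Option.elim o x₁ T)).toRingHom x₂ F₀).coeff g = 0) →
      (∀ g : ℤ, g < G → (Polynomial.eval₂ (MvPolynomial.aeval
        (fun o : Option (Fin (m + 3)) => Option.elim o x₁ T)).toRingHom x₂ F₁).coeff g = 0) →
      (∀ g : ℤ, g < G → (Polynomial.eval₂ (MvPolynomial.aeval
        (fun o : Option (Fin (m + 3)) => Option.elim o x₁ T)).toRingHom x₂ F₂).coeff g = 0) →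
      (∀ (j : ℕ) (e : Option (Fin (m + 3)) →₀ ℕ), e (some 2) ≠ 0 →
        MvPolynomial.coeff e (F₀.coeff j) = 0) →
      (∀ (j : ℕ) (e : Option (Fin (m + 3)) →₀ ℕ), e (some 2) ≠ 0 →
        MvPolynomial.coeff e (F₁.coeff j) = 0) →
      (∀ (j : ℕ) (e : Option (Fin (m + 3)) →₀ ℕ), e (some 2) ≠ 0 →
        MvPolynomial.coeff e ((F₂ + Polynomial.C (MvPolynomial.X (some 2))).coeff j) = 0) →
      (∀ i j : ℕ, i + j ≤ 1 → MvPolynomial.coeff (Finsupp.single none i) (F₀.coeff j) = 0) →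
      MvPolynomial.coeff (Finsupp.single none 0) (F₀.coeff 2) = 1 →
      MvPolynomial.coeff (Finsupp.single none 1) (F₀.coeff 1) = 0 →
      MvPolynomial.coeff (Finsupp.single none 2) (F₀.coeff 0) = 0 →
      (∀ i j : ℕ, i + j ≤ 1 → MvPolynomial.coeff (Finsupp.single none i) (F₁.coeff j) = 0) →
      MvPolynomial.coeff (Finsupp.single none 0) (F₁.coeff 2) = 0 →
      MvPolynomial.coeff (Finsupp.single none 1) (F₁.coeff 1) = 0 →
      MvPolynomial.coeff (Finsupp.single none 2) (F₁.coeff 0) = 1 →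
      MvPolynomial.coeff 0 (F₂.coeff 0) = 0 →
      ∃ D : MvPowerSeries (Fin (m + 3)) ℂ, MvPowerSeries.constantCoeff D = 0 ∧
        MvPowerSeries.coeff (Finsupp.single 2 8) D = 1 ∧
        ∀ g : ℤ, g < G → (MvPolynomial.aeval T (MvPowerSeries.truncTotal G D)).coeff g = 0 := by
  intro m G F₀ F₁ F₂ T x₁ x₂ hT hx₁ hx₂ hev0 hev1 hev2 hfr0 hfr1 hfr2 hu hu02 hu11 hu20 hv hv02 hv11
    hv20 hw00
  classical
  -- the embeddings `ℂ[W, X₁][X₂] → A₁⟦X₂⟧`, `A₁ = ℂ⟦W, X₁⟧`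
  set Fu : PowerSeries (MvPowerSeries (Option (Fin (m + 3))) ℂ) :=
    ((F₀.map MvPolynomial.coeToMvPowerSeries.ringHom :
      Polynomial (MvPowerSeries (Option (Fin (m + 3))) ℂ)) :
        PowerSeries (MvPowerSeries (Option (Fin (m + 3))) ℂ)) with hFu
  set Fv : PowerSeries (MvPowerSeries (Option (Fin (m + 3))) ℂ) :=
    ((F₁.map MvPolynomial.coeToMvPowerSeries.ringHom :
      Polynomial (MvPowerSeries (Option (Fin (m + 3))) ℂ)) :
        PowerSeries (MvPowerSeries (Option (Fin (m + 3))) ℂ)) with hFv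
  set Fw : PowerSeries (MvPowerSeries (Option (Fin (m + 3))) ℂ) :=
    ((F₂.map MvPolynomial.coeToMvPowerSeries.ringHom :
      Polynomial (MvPowerSeries (Option (Fin (m + 3))) ℂ)) :
        PowerSeries (MvPowerSeries (Option (Fin (m + 3))) ℂ)) with hFw
  have hsingle0 : (Finsupp.single none 0 : Option (Fin (m + 3)) →₀ ℕ) = 0 := Finsupp.single_zero _
  -- `Fu` is a Weierstrass divisor of order `2`
  have hu0 : ∀ j < 2, MvPowerSeries.constantCoeff (PowerSeries.coeff j Fu) = 0 := by
    intro j hj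
    rw [← MvPowerSeries.coeff_zero_eq_constantCoeff_apply, hFu, coeff_coeff_iota, ← hsingle0]
    exact hu 0 j (by omega)
  have hu2 : MvPowerSeries.constantCoeff (PowerSeries.coeff 2 Fu) ≠ 0 := by
    rw [← MvPowerSeries.coeff_zero_eq_constantCoeff_apply, hFu, coeff_coeff_iota, ← hsingle0, hu02]
    exact one_ne_zero
  -- LEVEL 1: divisions by `Fu`
  obtain ⟨Mv, Qv, Uv, Vv, hdivV, hUVv⟩ := eliminantMembership_option (m + 3) 2 Fu Fv (by norm_num) hu0 hu2
  obtain ⟨Mw, Qw, Uw, Vw, hdivW, hUVw⟩ := eliminantMembership_option (m + 3) 2 Fu Fw (by norm_num) hu0 hu2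
  -- the `X₁`-axis of `det Mv` (piece G)
  obtain ⟨hdet, hdet4⟩ := axis_det_order_four none Fu Fv Mv Qv
    (fun i j hij => by rw [hFu, coeff_coeff_iota]; exact hu i j hij)
    (by rw [hFu, coeff_coeff_iota]; exact hu02) (by rw [hFu, coeff_coeff_iota]; exact hu11)
    (by rw [hFu, coeff_coeff_iota]; exact hu20)
    (fun i j hij => by rw [hFv, coeff_coeff_iota]; exact hv i j hij)
    (by rw [hFv, coeff_coeff_iota]; exact hv02) (by rw [hFv, coeff_coeff_iota]; exact hv11)
    (by rw [hFv, coeff_coeff_iota]; exact hv20) hdivV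
  -- LEVEL 2: division by `Rv'` over `A = ℂ⟦W⟧`
  set Rv' : PowerSeries (MvPowerSeries (Fin (m + 3)) ℂ) :=
    Literature.RingTheory.MvPowerSeries.optionEquivLeft Mv.det with hRv'
  set Rw' : PowerSeries (MvPowerSeries (Fin (m + 3)) ℂ) :=
    Literature.RingTheory.MvPowerSeries.optionEquivLeft Mw.det with hRw'
  have h40 : ∀ j < 4, MvPowerSeries.constantCoeff (PowerSeries.coeff j Rv') = 0 := fun j hj => by
    rw [hRv', constantCoeff_coeff_optionEquivLeft]; exact hdet j hj
  have h44 : MvPowerSeries.constantCoeff (PowerSeries.coeff 4 Rv') ≠ 0 := by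
    rw [hRv', constantCoeff_coeff_optionEquivLeft, hdet4]; exact one_ne_zero
  obtain ⟨M₂, Q₂, U₂, V₂, hdiv2, hUV2⟩ :=
    corankOne_eliminantMembership (m + 3) 4 Rv' Rw' (by norm_num) h40 h44
  -- the leading monomial of `det M₂` (piece F): freeness from `W_2` and `Fw(0) ∈ (X₂)`
  have hFu : ∀ (j : ℕ) (e : Option (Fin (m + 3)) →₀ ℕ), e (some 2) ≠ 0 →
      MvPowerSeries.coeff e (PowerSeries.coeff j Fu) = 0 := fun j e he => by
    rw [hFu, coeff_coeff_iota]; exact hfr0 j e he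
  have hFv : ∀ (j : ℕ) (e : Option (Fin (m + 3)) →₀ ℕ), e (some 2) ≠ 0 →
      MvPowerSeries.coeff e (PowerSeries.coeff j Fv) = 0 := fun j e he => by
    rw [hFv, coeff_coeff_iota]; exact hfr1 j e he
  have hGw : ∀ (j : ℕ) (e : Option (Fin (m + 3)) →₀ ℕ), e (some 2) ≠ 0 →
      MvPowerSeries.coeff e (PowerSeries.coeff j
        (Fw + PowerSeries.C (MvPowerSeries.X (some 2)))) = 0 := fun j e he => by
    rw [hFw, ← coe_add_C_X, coeff_coeff_iota]; exact hfr2 j e he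
  have hFw0 : MvPowerSeries.constantCoeff (PowerSeries.coeff 0 Fw) = 0 := by
    rw [← MvPowerSeries.coeff_zero_eq_constantCoeff_apply, hFw, coeff_coeff_iota]; exact hw00
  obtain ⟨hD0, hD8⟩ := corankTwo_leadingMonomial (m + 3) 2 Fu Fv Fw Mv Mw Qv Qw Rv' Rw' M₂ Q₂
    hu0 hu2 hFu hFv hGw hFw0 hdivV hdivW hdet hdet4 hRv' hRw' hdiv2
  -- EVALUATION: level 1 (pieces H', E), level 2 (piece H)
  have hT' : ∀ o : Option (Fin (m + 3)), ∀ g : ℤ, g < 1 →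
      ((fun o : Option (Fin (m + 3)) => Option.elim o x₁ T) o).coeff g = 0 := by
    rintro (_ | i) g hg
    exacts [hx₁ g hg, hT i g hg]
  have hevV := evaluation_polynomial_sigma (Option (Fin (m + 3))) G F₀ F₁ Mv.det Uv Vv
    (fun o : Option (Fin (m + 3)) => Option.elim o x₁ T) x₂ hUVv hT' hx₂ hev0 hev1
  have hevW := evaluation_polynomial_sigma (Option (Fin (m + 3))) G F₀ F₂ Mw.det Uw Vw
    (fun o : Option (Fin (m + 3)) => Option.elim o x₁ T) x₂ hUVw hT' hx₂ hev0 hev2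
  have linkV := optionEquivLeft_truncation_link (m + 3) G Mv.det T x₁ hT hx₁
  have linkW := optionEquivLeft_truncation_link (m + 3) G Mw.det T x₁ hT hx₁
  have hDev := evaluation_powerSeries (Fin (m + 3)) G Rv' Rw' M₂.det U₂ V₂ T x₁ hUV2 hT hx₁
    (fun g hg => by rw [hRv', ← linkV g hg]; exact hevV g hg)
    (fun g hg => by rw [hRw', ← linkW g hg]; exact hevW g hg)
  exact ⟨M₂.det, hD0, hD8, hDev⟩

end NondegenerateCorankTwo

open CrossCap JetReduction NondegenerateCorankTwo in
/-- **Stub `stub_nondegenerateCorankTwo`** of line `registered` (skeleton v6) of the crux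
`BinomialElusive.BinomialCandidate`: a nondegenerate corank-two integral base point is
impossible for exponent data with (P1) no relation of length `≤ 2D` and (P2) a congruence
modulus with factor `D`, `D ≥ 8`. -/
theorem stub_nondegenerateCorankTwo :
    ∀ m ≥ 3, ∀ (D : ℕ) (a b : Fin m → ℕ) (Γ : Fin m → MvPolynomial (Fin (m - 1)) ℂ) (N : ℕ)
      (p : Fin (m - 1) → LaurentSeries ℂ), (∀ i, (Γ i).totalDegree ≤ 2) → 0 < N →
      (∀ j, 0 ≤ (p j).order) →
      (∀ i, 1 ≤ a i ∧ 1 ≤ b i) → 8 ≤ D →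
      (∀ u v : Fin m → ℤ, ∑ i, (|u i| + |v i|) ≤ 2 * (D : ℤ) →
        ∑ i, (u i * (a i : ℤ) + v i * (b i : ℤ)) = 0 → (u, v) = 0) →
      (∃ M' : ℕ, (∀ i, a i % M' = 1 ∧ b i % M' = 1) ∧
        (∀ i j, D * a i < M' * a j ∧ D * a i < M' * b j ∧ D * b i < M' * a j ∧ D * b i < M' * b j)) →
      ∀ (κ₁ κ₂ : Fin (m - 1) → ℂ) (lam : Fin 3 → Fin m → ℂ),
        (∀ i, ∑ j, κ₁ j * MvPolynomial.eval (fun l => (p l).coeff 0) (MvPolynomial.pderiv j (Γ i)) = 0) →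
        (∀ i, ∑ j, κ₂ j * MvPolynomial.eval (fun l => (p l).coeff 0) (MvPolynomial.pderiv j (Γ i)) = 0) →
        (∀ c₁ c₂ : ℂ, c₁ • κ₁ + c₂ • κ₂ = 0 → c₁ = 0 ∧ c₂ = 0) →
        (∀ κ' : Fin (m - 1) → ℂ,
          (∀ i, ∑ j, κ' j * MvPolynomial.eval (fun l => (p l).coeff 0) (MvPolynomial.pderiv j (Γ i)) = 0) →
          ∃ μ₁ μ₂ : ℂ, κ' = μ₁ • κ₁ + μ₂ • κ₂) →
        (∀ a : Fin 3, ∀ j : Fin (m - 1),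
          ∑ i, lam a i * MvPolynomial.eval (fun l => (p l).coeff 0) (MvPolynomial.pderiv j (Γ i)) = 0) →
        (∀ c : Fin 3 → ℂ, (∀ i, ∑ a, c a * lam a i = 0) → c = 0) →
        (∀ x₁ x₂ : ℂ, (∀ a : Fin 3, ∑ i, lam a i *
            MvPolynomial.eval (x₁ • κ₁ + x₂ • κ₂) (MvPolynomial.homogeneousComponent 2 (Γ i)) = 0) → x₁ = 0 ∧ x₂ = 0) →
        (∀ i, MvPolynomial.aeval p (Γ i) =
          HahnSeries.single ((N * a i : ℕ) : ℤ) (1 : ℂ) + HahnSeries.single ((N * b i : ℕ) : ℤ) (1 : ℂ)) →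
        False := by
  intro m hm D a b Γ N p hΓ hN hp hab hD hP1 hP2 κ₁ κ₂ lam hker₁ hker₂ hκ hcorank hlamJ hlam hnd hsol
  obtain ⟨n₀, rfl⟩ : ∃ n₀, m = n₀ + 3 := ⟨m - 3, by omega⟩
  classical
  -- 1. the binomials and the precision
  set T : Fin (n₀ + 3) → LaurentSeries ℂ := fun i =>
    HahnSeries.single ((N * a i : ℕ) : ℤ) (1 : ℂ) + HahnSeries.single ((N * b i : ℕ) : ℤ) (1 : ℂ) with hTdef
  have hT : ∀ i, ∀ g : ℤ, g < 1 → (T i).coeff g = 0 := fun i =>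
    vanish_binomial (hab i).1 (hab i).2 hN
  set G : ℕ := 2 * D * N * ∑ i, (a i + b i) + 1 with hGdef
  have hGbound : ∀ i, (D : ℤ) * ((N * a i : ℕ) : ℤ) < G ∧ (D : ℤ) * ((N * b i : ℕ) : ℤ) < G := by
    intro i
    have hi : a i + b i ≤ ∑ i, (a i + b i) :=
      Finset.single_le_sum (f := fun i => a i + b i) (fun _ _ => Nat.zero_le _) (Finset.mem_univ i)
    have key : ∀ c, c ≤ ∑ i, (a i + b i) → D * (N * c) < G := by
      intro c hc
      rw [hGdef]
      calc D * (N * c) ≤ D * (N * ∑ i, (a i + b i)) := Nat.mul_le_mul_left _ (Nat.mul_le_mul_left _ hc)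
        _ ≤ 2 * D * N * ∑ i, (a i + b i) := by
            rw [show 2 * D * N * ∑ i, (a i + b i) = 2 * (D * (N * ∑ i, (a i + b i))) by ring]; omega
        _ < _ := Nat.lt_succ_self _
    exact ⟨by exact_mod_cast key _ (le_trans (Nat.le_add_right _ _) hi),
      by exact_mod_cast key _ (le_trans (Nat.le_add_left _ _) hi)⟩
  have hDG : D < G := by
    have := (hGbound 0).1
    have h1 : (1 : ℤ) ≤ ((N * a 0 : ℕ) : ℤ) := by exact_mod_cast Nat.mul_pos hN (hab 0).1
    have h2 : (D : ℤ) ≤ (D : ℤ) * ((N * a 0 : ℕ) : ℤ) := by nlinarith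
    omega
  -- 2. adapted kernel basis and functionals
  obtain ⟨κ₁', κ₂', lam', hker₁', hker₂', hκ', hcorank', hlamJ', hlam', n00, n01, n02, n10, n11,
      n12⟩ :=
    nondegenerateCorankTwo_adaptedBasis (n₀ + 2) (n₀ + 3)
      (fun i => homogeneousComponent 2 (Γ i))
      (fun i j => eval (fun l => (p l).coeff 0) (pderiv j (Γ i))) κ₁ κ₂ lam
      (fun i => homogeneousComponent_isHomogeneous 2 (Γ i)) hker₁ hker₂ hκ hcorank hlamJ hlam hnd
  -- 3. normal form
  obtain ⟨P, P', S, _S', B, q, hPP', _hP'P, _hSS', _hS'S, hS0, hS1, hProws, _hBdeg, hB, hq, _hpq,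
      _hNFreg, hNF0, hNF1, _hNF2, hreg, h0, h1, h2⟩ :=
    corankTwo_normalForm n₀ Γ p T κ₁' κ₂' lam' hΓ hp hT hsol hker₁' hker₂' hκ' hcorank' hlamJ' hlam'
  -- quadratic normalisation: `[Y_1²] B_0 = 1`, `[Y_0²] B_1 = 1`, all other quadratic
  -- kernel-plane coefficients of `B_0`, `B_1` vanish
  have hKP := fun i' => kernelPlane_coefficients n₀ (Γ i') (hΓ i') (fun l => (p l).coeff 0) S
  set aff : Fin (n₀ + 2) → MvPolynomial (Fin (n₀ + 2)) ℂ :=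
    fun j => C ((p j).coeff 0) + ∑ l, C (S j l) * X l with haff
  have hS0' : (fun j => S j 0) = κ₁' := funext hS0
  have hS1' : (fun j => S j 1) = κ₂' := funext hS1
  have csum : ∀ (c : Fin (n₀ + 3) → ℂ) (e : Fin (n₀ + 2) →₀ ℕ),
      coeff e (∑ i', C (c i') * aeval aff (Γ i')) = ∑ i', c i' * coeff e (aeval aff (Γ i')) :=
    fun c e => by rw [coeff_sum]; simp only [coeff_C_mul]
  have q1 : ∀ i', coeff (Finsupp.single 0 2) (aeval aff (Γ i')) =
      eval κ₁' (homogeneousComponent 2 (Γ i')) := fun i' => by rw [(hKP i').1, hS0']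
  have q2 : ∀ i', coeff (Finsupp.single 1 2) (aeval aff (Γ i')) =
      eval κ₂' (homogeneousComponent 2 (Γ i')) := fun i' => by rw [(hKP i').2.1, hS1']
  have q3 : ∀ i', coeff (Finsupp.single 0 1 + Finsupp.single 1 1) (aeval aff (Γ i')) =
      ∑ j, κ₂' j * eval κ₁' (pderiv j (homogeneousComponent 2 (Γ i'))) := fun i' => by
    rw [(hKP i').2.2.1, hS0']
    exact Finset.sum_congr rfl fun j _ => by rw [hS1]
  have hP0 : ∀ i', P 0 i' = lam' 0 i' := fun i' => (hProws i').1
  have hP1r : ∀ i', P 1 i' = lam' 1 i' := fun i' => (hProws i').2.1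
  have b0_20 : coeff (Finsupp.single 0 2) (B 0) = 0 := by
    rw [← hNF0, csum]; simp only [q1, hP0]; exact n00
  have b0_11 : coeff (Finsupp.single 0 1 + Finsupp.single 1 1) (B 0) = 0 := by
    rw [← hNF0, csum]; simp only [q3, hP0]; exact n01
  have b0_02 : coeff (Finsupp.single 1 2) (B 0) = 1 := by
    rw [← hNF0, csum]; simp only [q2, hP0]; exact n02
  have b1_20 : coeff (Finsupp.single 0 2) (B 1) = 1 := by
    rw [← hNF1, csum]; simp only [q1, hP1r]; exact n10
  have b1_11 : coeff (Finsupp.single 0 1 + Finsupp.single 1 1) (B 1) = 0 := by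
    rw [← hNF1, csum]; simp only [q3, hP1r]; exact n11
  have b1_02 : coeff (Finsupp.single 1 2) (B 1) = 0 := by
    rw [← hNF1, csum]; simp only [q2, hP1r]; exact n12
  -- 4. Picard elimination of the regular coordinates
  set Th : Fin (n₀ + 3) → LaurentSeries ℂ := fun i => ∑ i', algebraMap ℂ (LaurentSeries ℂ) (P i i') * T i'
    with hThdef
  have hTh : ∀ i, ∀ g : ℤ, g < 1 → (Th i).coeff g = 0 := fun i =>
    vanish_sum _ _ fun i' _ => by simpa using vanish_mul (vanish_algebraMap (P i i')) (hT i')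
  obtain ⟨F₀, F₁, F₂, φ, hfree, hev0, hev1, hev2, -, hpure, hφ2, -⟩ :=
    corankTwo_iteration_v2 n₀ G 3 B q Th hB hq hTh hreg h0 h1 h2
  -- pure parts on the kernel surface `(X_0, X_1, φ)`
  have hpl1 : ∀ l, ∀ d : Fin 2 →₀ ℕ, d.degree < 1 →
      coeff d ((Fin.cons (X 0) (Fin.cons (X 1) φ) : Fin (n₀ + 2) → MvPolynomial (Fin 2) ℂ) l) = 0 :=
    fun l => Fin.cases (degGE_X 0) (fun l' => Fin.cases (degGE_X 1)
      (fun j' d hd => hφ2 j' d (by omega)) l') l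
  have low : ∀ (a' : Fin (n₀ + 3)) (i j : ℕ), i + j ≤ 1 →
      coeff (Finsupp.single 0 i + Finsupp.single 1 j) (aeval (Fin.cons (X 0) (Fin.cons (X 1) φ) :
        Fin (n₀ + 2) → MvPolynomial (Fin 2) ℂ) (B a')) = 0 := fun a' i j hij =>
    aeval_degGE (hB a') hpl1 _ (by simp only [map_add, Finsupp.degree_single]; omega)
  have two : ∀ (a' : Fin (n₀ + 3)) (i j : ℕ), i + j < 3 →
      coeff (Finsupp.single 0 i + Finsupp.single 1 j) (aeval (Fin.cons (X 0) (Fin.cons (X 1) φ) :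
        Fin (n₀ + 2) → MvPolynomial (Fin 2) ℂ) (B a')) =
        coeff (Finsupp.single 0 i + Finsupp.single 1 j) (B a') := fun a' i j hij =>
    coeff_aeval_plane φ hφ2 (B a') (hB a') i j hij
  have hu : ∀ i j : ℕ, i + j ≤ 1 → coeff (Finsupp.single none i) (F₀.coeff j) = 0 :=
    fun i j hij => by rw [(hpure i j).1]; exact low 0 i j hij
  have hu02 : coeff (Finsupp.single none 0) (F₀.coeff 2) = 1 := by
    rw [(hpure 0 2).1, two 0 0 2 (by norm_num), Finsupp.single_zero, zero_add]; exact b0_02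
  have hu11 : coeff (Finsupp.single none 1) (F₀.coeff 1) = 0 := by
    rw [(hpure 1 1).1, two 0 1 1 (by norm_num)]; exact b0_11
  have hu20 : coeff (Finsupp.single none 2) (F₀.coeff 0) = 0 := by
    rw [(hpure 2 0).1, two 0 2 0 (by norm_num), Finsupp.single_zero, add_zero]; exact b0_20
  have hv : ∀ i j : ℕ, i + j ≤ 1 → coeff (Finsupp.single none i) (F₁.coeff j) = 0 :=
    fun i j hij => by rw [(hpure i j).2.1]; exact low 1 i j hij
  have hv02 : coeff (Finsupp.single none 0) (F₁.coeff 2) = 0 := by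
    rw [(hpure 0 2).2.1, two 1 0 2 (by norm_num), Finsupp.single_zero, zero_add]; exact b1_02
  have hv11 : coeff (Finsupp.single none 1) (F₁.coeff 1) = 0 := by
    rw [(hpure 1 1).2.1, two 1 1 1 (by norm_num)]; exact b1_11
  have hv20 : coeff (Finsupp.single none 2) (F₁.coeff 0) = 1 := by
    rw [(hpure 2 0).2.1, two 1 2 0 (by norm_num), Finsupp.single_zero, add_zero]; exact b1_20
  have hw00 : coeff 0 (F₂.coeff 0) = 0 := by
    have h := (hpure 0 0).2.2
    rw [low 2 0 0 (by norm_num), Finsupp.single_zero] at h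
    exact h
  -- freeness from the special target variable `W_2`
  have h02 : (0 : Fin (n₀ + 3)) ≠ 2 := by rw [Ne, Fin.ext_iff, Fin.val_zero, Fin.val_two]; omega
  have h12 : (1 : Fin (n₀ + 3)) ≠ 2 := by rw [Ne, Fin.ext_iff, Fin.val_one, Fin.val_two]; omega
  have hXfree : ∀ (s : Fin (n₀ + 3)) (j : ℕ) (e : Option (Fin (n₀ + 3)) →₀ ℕ), e (some 2) ≠ 0 →
      s ≠ 2 → coeff e ((Polynomial.C (X (some s)) :
        Polynomial (MvPolynomial (Option (Fin (n₀ + 3))) ℂ)).coeff j) = 0 := by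
    intro s j e he hs
    rw [Polynomial.coeff_C]
    split_ifs
    · rw [coeff_X, if_neg]
      intro h
      apply he
      rw [← h, Finsupp.single_apply, if_neg fun h' => hs (Option.some_injective _ h')]
    · exact coeff_zero _
  have hfr0 : ∀ (j : ℕ) (e : Option (Fin (n₀ + 3)) →₀ ℕ), e (some 2) ≠ 0 →
      coeff e (F₀.coeff j) = 0 := fun j e he => by
    have h := (hfree j e (Or.inr (Or.inr he))).1
    rwa [Polynomial.coeff_add, coeff_add, hXfree 0 j e he h02, add_zero] at h
  have hfr1 : ∀ (j : ℕ) (e : Option (Fin (n₀ + 3)) →₀ ℕ), e (some 2) ≠ 0 →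
      coeff e (F₁.coeff j) = 0 := fun j e he => by
    have h := (hfree j e (Or.inr (Or.inr he))).2.1
    rwa [Polynomial.coeff_add, coeff_add, hXfree 1 j e he h12, add_zero] at h
  have hfr2 : ∀ (j : ℕ) (e : Option (Fin (n₀ + 3)) →₀ ℕ), e (some 2) ≠ 0 →
      coeff e ((F₂ + Polynomial.C (X (some 2))).coeff j) = 0 := fun j e he =>
    (hfree j e (Or.inr (Or.inr he))).2.2
  -- 5.–7. the two-level Weierstrass elimination and its evaluation
  obtain ⟨Dm, hD0, hD8, hDev⟩ := twoLevel_elimination n₀ G F₀ F₁ F₂ Th (q 0) (q 1) hTh (hq 0)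
    (hq 1) hev0 hev1 hev2 hfr0 hfr1 hfr2 hu hu02 hu11 hu20 hv hv02 hv11 hv20 hw00
  -- 8. (P1) at length `16`, (P2) with factor `8`, precision at level `8`
  have hP1d : ∀ u v : Fin (n₀ + 3) → ℤ, ∑ i, (|u i| + |v i|) ≤ 2 * ((8 : ℕ) : ℤ) →
      ∑ i, (u i * (a i : ℤ) + v i * (b i : ℤ)) = 0 → (u, v) = 0 :=
    fun u v hlen hrel => hP1 u v (hlen.trans (by push_cast; omega)) hrel
  have hP2d : ∃ M' : ℕ, (∀ i, a i % M' = 1 ∧ b i % M' = 1) ∧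
      (∀ i j, 8 * a i < M' * a j ∧ 8 * a i < M' * b j ∧ 8 * b i < M' * a j ∧ 8 * b i < M' * b j) := by
    obtain ⟨M', hmod, hlt⟩ := hP2
    have h8 : ∀ c, 8 * c ≤ D * c := fun c => Nat.mul_le_mul_right _ hD
    exact ⟨M', hmod, fun i j => ⟨(h8 _).trans_lt (hlt i j).1, (h8 _).trans_lt (hlt i j).2.1,
      (h8 _).trans_lt (hlt i j).2.2.1, (h8 _).trans_lt (hlt i j).2.2.2⟩⟩
  have hG8 : ∀ i, ((8 : ℕ) : ℤ) * ((N * a i : ℕ) : ℤ) < G ∧ ((8 : ℕ) : ℤ) * ((N * b i : ℕ) : ℤ) < G := by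
    intro i
    have h8 : ((8 : ℕ) : ℤ) ≤ D := by exact_mod_cast hD
    have h1 : (0 : ℤ) ≤ ((N * a i : ℕ) : ℤ) := by positivity
    have h2 : (0 : ℤ) ≤ ((N * b i : ℕ) : ℤ) := by positivity
    exact ⟨lt_of_le_of_lt (mul_le_mul_of_nonneg_right h8 h1) (hGbound i).1,
      lt_of_le_of_lt (mul_le_mul_of_nonneg_right h8 h2) (hGbound i).2⟩
  -- transfer to the binomials
  set D' : MvPolynomial (Fin (n₀ + 3)) ℂ := MvPowerSeries.truncTotal G Dm with hD'def
  set ψ : MvPolynomial (Fin (n₀ + 3)) ℂ := aeval (fun i => ∑ i', C (P i i') * X i') D' with hψdef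
  have hψT : aeval T ψ = aeval Th D' := by
    have hfun : (fun i => aeval T (∑ i', C (P i i') * X i')) = Th := by
      funext i; rw [aeval_linear]
    rw [hψdef, aeval_aeval, hfun]
  have hD'1 : ∀ e : Fin (n₀ + 3) →₀ ℕ, e.degree < 1 → coeff e D' = 0 := by
    intro e he
    have he0 : e = 0 := (Finsupp.degree_eq_zero_iff e).mp (by omega)
    rw [he0, hD'def, MvPowerSeries.coeff_truncTotal _ (by simp; omega),
      MvPowerSeries.coeff_zero_eq_constantCoeff_apply, hD0]
  have lin_mem : ∀ (M₁ : Matrix (Fin (n₀ + 3)) (Fin (n₀ + 3)) ℂ) (i : Fin (n₀ + 3)),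
      ∀ e : Fin (n₀ + 3) →₀ ℕ, e.degree < 1 → coeff e (∑ i', C (M₁ i i') * X i') = 0 := fun M₁ i =>
    degGE_sum _ fun l _ => degGE_C_mul _ (degGE_X l)
  have hψcc : MvPolynomial.constantCoeff ψ = 0 := by
    rw [MvPolynomial.constantCoeff_eq]
    exact aeval_degGE hD'1 (lin_mem P) 0 (by simp)
  have hlow := lowDegreeVanishing_deg (n₀ + 3) 8 a b N hN (by norm_num) hP1d hP2d ψ G hψcc hG8
    (fun g hg => by rw [hψT]; exact hDev g hg)
  have hψd : ∀ e : Fin (n₀ + 3) →₀ ℕ, e.degree < 8 + 1 → coeff e ψ = 0 := by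
    intro e he
    refine hlow e ?_
    have : (e.sum fun _ n => n) = e.degree := by rw [Finsupp.degree_apply]; rfl
    omega
  -- undo `P`
  have hback : aeval (fun i => ∑ l, C (P' i l) * X l) ψ = D' := by
    rw [hψdef, aeval_aeval]
    have : (fun i => aeval (fun i => ∑ l, C (P' i l) * X l) (∑ i', C (P i i') * X i')) =
        fun i => (X i : MvPolynomial (Fin (n₀ + 3)) ℂ) := by
      funext i
      rw [aeval_linear, MvPolynomial.algebraMap_eq, sum_C_mul_linear]
      exact linear_eq_X_of_mul_eq_one hPP' i
    rw [this, aeval_X_left, AlgHom.id_apply]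
  have hD'd : ∀ e : Fin (n₀ + 3) →₀ ℕ, e.degree < 8 + 1 → coeff e D' = 0 := by
    rw [← hback]
    exact aeval_degGE hψd (lin_mem P')
  have h8 := hD'd (Finsupp.single 2 8) (by simp)
  rw [hD'def, MvPowerSeries.coeff_truncTotal _ (by simp; omega), hD8] at h8
  exact one_ne_zero h8

end Summit.ValiantsHypothesis.ValiantsHypothesis.Theorems.BinomialCandidateStubs

end
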